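import Summits.KontsevichZagierPeriods.KontsevichZagierPeriods.Theorems.FurushoPentagonPentagonInKZCornerBridge
import Summits.KontsevichZagierPeriods.KontsevichZagierPeriods.Theorems.FurushoPentagonPentagonInKZPolyIdentity
import Literature.NumberTheory.Transcendental.AssociatorsHexagonProofs

/-!
# `PentagonInKZ`: the corner principle for bilinear corner charts (corner principle, aux 2)

Helper for the registered stub `stub_cornerPrinciple` of the crux `FurushoPentagon.PentagonInKZ`
(stmt-KontsevichZagierPeriods-11348; registered helper `cornerPrinciple_chart`): the letter maps
of the horizontal/vertical families, the truncated series through the bridge (`evalTrunc_eq`),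
and the assembly `corner_principle`: for a flat, axis-central bilinear corner chart (hypotheses in
the target algebra) the end-regularised transports of the four sides of the box satisfy
`V_α · H_0 = H_β · V_0` at truncated residues — the KITE and the corner product identity of
`Literature/…/KZCubeKite`; plus the generic algebra of the transfer of real flatness hypotheses
(`CornerTransfer.comm_sum_smul`, `commute_of_double_sum`, `sum_aeval_smul_eq_zero`).
[cite: Furusho2010, §3]
-/

noncomputable section

open MeasureTheory Set MvPolynomial

namespace Summit.KontsevichZagierPeriods.FurushoPentagon.PentagonInKZ

open Literature.NumberTheory.Transcendental Literature.NumberTheory.Transcendental.KZ Literature.NumberTheory.Transcendental.KZ.Cube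

/-! ## The corner principle for bilinear corner charts -/

section CornerPrinciple

open Shuffle NCSeries CornerChart

variable {m : ℕ} (Γ : CornerChart m)
variable {R : Type} [CommRing R] [Algebra ℚ R] {χ : KZ.FormalRep →+ R} (hrel : ∀ c ∈ KZ.relations, χ c = 0)
variable (hmul : ∀ x y : KZ.FormalRep, χ (x * y) = χ x * χ y)

/-- The letter map of the horizontal families: axis `0`, divisors `ℓ ↦ ℓ + 2`. [folklore] -/
def eH : Option (Fin m) → Fin (m + 2) := fun a => a.elim 0 fun ℓ => ℓ.addNat 2

/-- The letter map of the vertical families: axis `1`, divisors `ℓ ↦ ℓ + 2`. [folklore] -/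
def eV : Option (Fin m) → Fin (m + 2) := fun a => a.elim 1 fun ℓ => ℓ.addNat 2

omit Γ in
/-- `eH` is injective. [folklore] -/
theorem eH_injective : Function.Injective (eH (m := m)) := by
  intro a b h
  have hv := congrArg Fin.val h
  cases a with
  | none =>
    cases b with
    | none => rfl
    | some ℓ => simp only [eH, Option.elim, Fin.val_zero, Fin.val_addNat] at hv; omega
  | some ℓ =>
    cases b with
    | none => simp only [eH, Option.elim, Fin.val_zero, Fin.val_addNat] at hv; omega
    | some ℓ' => simp only [eH, Option.elim, Fin.val_addNat] at hv; exact congrArg some (Fin.ext (by omega))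

omit Γ in
/-- `eV` is injective. [folklore] -/
theorem eV_injective : Function.Injective (eV (m := m)) := by
  intro a b h
  have hv := congrArg Fin.val h
  cases a with
  | none =>
    cases b with
    | none => rfl
    | some ℓ => simp only [eV, Option.elim, Fin.val_one, Fin.val_addNat] at hv; omega
  | some ℓ =>
    cases b with
    | none => simp only [eV, Option.elim, Fin.val_one, Fin.val_addNat] at hv; omega
    | some ℓ' => simp only [eV, Option.elim, Fin.val_addNat] at hv; exact congrArg some (Fin.ext (by omega))

omit Γ in
/-- The only letter missed by `eH` is the other axis `1`. [folklore] -/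
theorem eq_one_of_not_mem_range_eH {b : Fin (m + 2)} (hb : b ∉ Set.range (eH (m := m))) : b = 1 := by
  by_contra h1
  apply hb
  by_cases h0 : b = 0
  · exact ⟨none, h0 ▸ rfl⟩
  · have hb2 : 2 ≤ b.val := by
      have : b.val ≠ 0 := fun h => h0 (Fin.ext h)
      have : b.val ≠ 1 := fun h => h1 (Fin.ext h)
      omega
    exact ⟨some ⟨b.val - 2, by omega⟩, Fin.ext (by simp [eH]; omega)⟩

omit Γ in
/-- The only letter missed by `eV` is the other axis `0`. [folklore] -/
theorem eq_zero_of_not_mem_range_eV {b : Fin (m + 2)} (hb : b ∉ Set.range (eV (m := m))) : b = 0 := by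
  by_contra h0
  apply hb
  by_cases h1 : b = 1
  · exact ⟨none, h1 ▸ rfl⟩
  · have hb2 : 2 ≤ b.val := by
      have : b.val ≠ 0 := fun h => h0 (Fin.ext h)
      have : b.val ≠ 1 := fun h => h1 (Fin.ext h)
      omega
    exact ⟨some ⟨b.val - 2, by omega⟩, Fin.ext (by simp [eV]; omega)⟩

/-- Constant values of the rider-free data (`Y := 1`). [folklore] -/
theorem cvals (ℓ : Fin m) :
    cval ((Γ.Dx.substY (k := 0) 1 isScale_one0).N ℓ) = Γ.cB ℓ + Γ.cD ℓ * Γ.β ∧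
    cval ((Γ.Dx.substY (k := 0) 1 isScale_one0).M ℓ) = Γ.cA ℓ + Γ.cC ℓ * Γ.β ∧
    cval ((Γ.D0x.substY (k := 0) 1 isScale_one0).N ℓ) = Γ.cB ℓ ∧
    cval ((Γ.D0x.substY (k := 0) 1 isScale_one0).M ℓ) = Γ.cA ℓ ∧
    cval ((Γ.Dy.substY (k := 0) 1 isScale_one0).N ℓ) = Γ.cC ℓ + Γ.cD ℓ * Γ.α ∧
    cval ((Γ.Dy.substY (k := 0) 1 isScale_one0).M ℓ) = Γ.cA ℓ + Γ.cB ℓ * Γ.α ∧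
    cval ((Γ.D0y.substY (k := 0) 1 isScale_one0).N ℓ) = Γ.cC ℓ ∧
    cval ((Γ.D0y.substY (k := 0) 1 isScale_one0).M ℓ) = Γ.cA ℓ := by
  refine ⟨?_, ?_, ?_, ?_, ?_, ?_, ?_, ?_⟩ <;>
    simp only [cval, DirData.substY, Dx, D0x, Dy, D0y, eval_substY_affine, MvPolynomial.bind₁_C_right, MvPolynomial.eval_C, map_one, mul_one]

variable {A : Type} [Ring A] [Algebra R A] [Module ℚ A] [IsScalarTower ℚ R A]

omit [Module ℚ A] [IsScalarTower ℚ R A] in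
/-- **Vanishing of the cube series above the truncation degree.** [folklore] -/
theorem Q_eq_zero_of_trunc (D : DirData (Fin m) (0 + 1)) (e : Option (Fin m) → Fin (m + 2)) (Z : Fin (m + 2) → A) {N n : ℕ}
    (hN : ∀ w : List (Fin (m + 2)), N < w.length → (w.map Z).prod = 0) (hn : N < n) :
    KiteData.Q (χ := χ) D (fun a => Z (e a)) n = 0 := by
  rw [KiteData.Q, ZS, NCSeries.evalW]
  refine Finset.sum_eq_zero fun g _ => ?_
  rw [List.map_ofFn, show (List.ofFn ((fun a => Z (e a)) ∘ g)) = (List.ofFn (e ∘ g)).map Z from by rw [List.map_ofFn]; rfl,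
    hN _ (by simp [hn]), smul_zero]

include hrel in
omit [Module ℚ A] [IsScalarTower ℚ R A] in
/-- **From the bridge to the truncated series**: `evalTrunc N Z P = 1 + Σ_{j<N} c̄ • Q_{j+1}`. [folklore] -/
theorem evalTrunc_eq (D : DirData (Fin m) (0 + 1)) (hc : 0 < D.c) (e : Option (Fin m) → Fin (m + 2)) (he : Function.Injective e)
    (dens : Fin (m + 2) → ℝ → ℝ)
    (hnone : ∀ s : ℝ, 0 < s → s < (D.c : ℝ) → dens (e none) s = 1 / s)
    (hsome : ∀ (ℓ : Fin m) (s : ℝ), 0 < s → s < (D.c : ℝ) → dens (e (some ℓ)) s =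
      (cval ((D.substY (k := 0) 1 isScale_one0).N ℓ) : ℝ) / ((cval ((D.substY (k := 0) 1 isScale_one0).N ℓ) : ℝ) * s +
        (cval ((D.substY (k := 0) 1 isScale_one0).M ℓ) : ℝ)))
    (hout : ∀ b : Fin (m + 2), b ∉ Set.range e → ∀ s : ℝ, 0 < s → s < (D.c : ℝ) → dens b s = 0)
    (I : (w : List (Fin (m + 2))) → KZ.IntegralRep w.length)
    (hI : ∀ w : List (Fin (m + 2)), w.getLast? ≠ some (e none) → (I w).domain = {t | (∀ i, 0 < t i ∧ t i < (D.c : ℝ)) ∧ StrictAnti t} ∧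
      Set.EqOn (I w).integrand (fun t => ∏ i, dens (w.get i) (t i)) (I w).domain)
    (P : NCSeries (Fin (m + 2)) R) (hP : ∀ W, P W = if W = [] then 1 else pair (fun w => χ (KZ.of (I w))) (regEnd (e none) W))
    (Z : Fin (m + 2) → A) (N : ℕ) :
    NCSeries.evalTrunc N Z P = 1 + ∑ j ∈ Finset.range N, algebraMap ℚ R D.c • KiteData.Q (χ := χ) D (fun a => Z (e a)) (j + 1) := by
  rw [NCSeries.evalTrunc_eq_sum_evalW, Finset.sum_range_succ', NCSeries.evalW_zero, hP, if_pos rfl, one_smul, add_comm]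
  congr 1
  refine Finset.sum_congr rfl fun j _ => ?_
  exact evalW_bridge hrel (D.substY (k := 0) 1 isScale_one0) hc e he dens hnone hsome hout I hI P hP Z (Nat.succ_pos j)

include hrel hmul in
/-- **THE CORNER PRINCIPLE for a flat, axis-central bilinear corner chart** (formal version over any
realisation `χ` of the Kontsevich–Zagier rules): the end-regularised transports of the four sides of
the box `[0,α] × [0,β]`, read at truncated residues, satisfy `V_α · H_0 = H_β · V_0`.
[cite: Furusho2010, §3] -/
theorem corner_principle (Z : Fin (m + 2) → A) {N : ℕ} (hN : ∀ w : List (Fin (m + 2)), N < w.length → (w.map Z).prod = 0)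
    (h01 : Commute (Z 0) (Z 1))
    (F1Q : ∀ x y : ℚ, 0 ≤ x → x ≤ Γ.α → 0 ≤ y → y ≤ Γ.β →
      Commute (Z 0 + ∑ ℓ, algebraMap ℚ R ((Γ.cB ℓ + Γ.cD ℓ * y) * x / Γ.φQ ℓ x y) • Z (ℓ.addNat 2))
        (Z 1 + ∑ ℓ, algebraMap ℚ R ((Γ.cC ℓ + Γ.cD ℓ * x) * y / Γ.φQ ℓ x y) • Z (ℓ.addNat 2)))
    (F2Q : ∀ y : ℚ, 0 < y → y < Γ.β → Commute (Z 0) (Z 1 + ∑ ℓ, algebraMap ℚ R (Γ.cC ℓ * y / (Γ.cA ℓ + Γ.cC ℓ * y)) • Z (ℓ.addNat 2)))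
    (F3Q : ∀ x : ℚ, 0 < x → x < Γ.α → Commute (Z 1) (Z 0 + ∑ ℓ, algebraMap ℚ R (Γ.cB ℓ * x / (Γ.cA ℓ + Γ.cB ℓ * x)) • Z (ℓ.addNat 2)))
    (dHlo dHhi dVlo dVhi : Fin (m + 2) → ℝ → ℝ)
    (hHlo0 : ∀ s : ℝ, 0 < s → s < Γ.α → dHlo 0 s = 1 / s) (hHlo1 : ∀ s : ℝ, 0 < s → s < Γ.α → dHlo 1 s = 0)
    (hHlo : ∀ (ℓ : Fin m) (s : ℝ), 0 < s → s < Γ.α → dHlo (ℓ.addNat 2) s = (Γ.cB ℓ : ℝ) / ((Γ.cB ℓ : ℝ) * s + Γ.cA ℓ))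
    (hHhi0 : ∀ s : ℝ, 0 < s → s < Γ.α → dHhi 0 s = 1 / s) (hHhi1 : ∀ s : ℝ, 0 < s → s < Γ.α → dHhi 1 s = 0)
    (hHhi : ∀ (ℓ : Fin m) (s : ℝ), 0 < s → s < Γ.α →
      dHhi (ℓ.addNat 2) s = ((Γ.cB ℓ + Γ.cD ℓ * Γ.β : ℚ) : ℝ) / (((Γ.cB ℓ + Γ.cD ℓ * Γ.β : ℚ) : ℝ) * s + ((Γ.cA ℓ + Γ.cC ℓ * Γ.β : ℚ) : ℝ)))
    (hVlo1 : ∀ s : ℝ, 0 < s → s < Γ.β → dVlo 1 s = 1 / s) (hVlo0 : ∀ s : ℝ, 0 < s → s < Γ.β → dVlo 0 s = 0)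
    (hVlo : ∀ (ℓ : Fin m) (s : ℝ), 0 < s → s < Γ.β → dVlo (ℓ.addNat 2) s = (Γ.cC ℓ : ℝ) / ((Γ.cC ℓ : ℝ) * s + Γ.cA ℓ))
    (hVhi1 : ∀ s : ℝ, 0 < s → s < Γ.β → dVhi 1 s = 1 / s) (hVhi0 : ∀ s : ℝ, 0 < s → s < Γ.β → dVhi 0 s = 0)
    (hVhi : ∀ (ℓ : Fin m) (s : ℝ), 0 < s → s < Γ.β →
      dVhi (ℓ.addNat 2) s = ((Γ.cC ℓ + Γ.cD ℓ * Γ.α : ℚ) : ℝ) / (((Γ.cC ℓ + Γ.cD ℓ * Γ.α : ℚ) : ℝ) * s + ((Γ.cA ℓ + Γ.cB ℓ * Γ.α : ℚ) : ℝ)))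
    (IHlo IHhi IVlo IVhi : (w : List (Fin (m + 2))) → KZ.IntegralRep w.length)
    (hIHlo : ∀ w : List (Fin (m + 2)), w.getLast? ≠ some 0 → (IHlo w).domain = {t | (∀ i, 0 < t i ∧ t i < (Γ.α : ℝ)) ∧ StrictAnti t} ∧
      Set.EqOn (IHlo w).integrand (fun t => ∏ i, dHlo (w.get i) (t i)) (IHlo w).domain)
    (hIHhi : ∀ w : List (Fin (m + 2)), w.getLast? ≠ some 0 → (IHhi w).domain = {t | (∀ i, 0 < t i ∧ t i < (Γ.α : ℝ)) ∧ StrictAnti t} ∧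
      Set.EqOn (IHhi w).integrand (fun t => ∏ i, dHhi (w.get i) (t i)) (IHhi w).domain)
    (hIVlo : ∀ w : List (Fin (m + 2)), w.getLast? ≠ some 1 → (IVlo w).domain = {t | (∀ i, 0 < t i ∧ t i < (Γ.β : ℝ)) ∧ StrictAnti t} ∧
      Set.EqOn (IVlo w).integrand (fun t => ∏ i, dVlo (w.get i) (t i)) (IVlo w).domain)
    (hIVhi : ∀ w : List (Fin (m + 2)), w.getLast? ≠ some 1 → (IVhi w).domain = {t | (∀ i, 0 < t i ∧ t i < (Γ.β : ℝ)) ∧ StrictAnti t} ∧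
      Set.EqOn (IVhi w).integrand (fun t => ∏ i, dVhi (w.get i) (t i)) (IVhi w).domain)
    (PHlo PHhi PVlo PVhi : NCSeries (Fin (m + 2)) R)
    (hPHlo : ∀ W, PHlo W = if W = [] then 1 else pair (fun w => χ (KZ.of (IHlo w))) (regEnd 0 W))
    (hPHhi : ∀ W, PHhi W = if W = [] then 1 else pair (fun w => χ (KZ.of (IHhi w))) (regEnd 0 W))
    (hPVlo : ∀ W, PVlo W = if W = [] then 1 else pair (fun w => χ (KZ.of (IVlo w))) (regEnd 1 W))
    (hPVhi : ∀ W, PVhi W = if W = [] then 1 else pair (fun w => χ (KZ.of (IVhi w))) (regEnd 1 W)) :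
    NCSeries.evalTrunc N Z PVhi * NCSeries.evalTrunc N Z PHlo = NCSeries.evalTrunc N Z PHhi * NCSeries.evalTrunc N Z PVlo := by
  -- the kite of the chart at the residues
  have H := Γ.kite_hyp (R := R) (fun ℓ => Z (ℓ.addNat 2)) (Z 0) (Z 1) h01 F1Q F2Q F3Q
  have hresH : (fun a => Z (eH a)) = resid (fun ℓ => Z (ℓ.addNat 2)) (Z 0) := funext fun a => by cases a <;> rfl
  have hresV : (fun a => Z (eV a)) = resid (fun ℓ => Z (ℓ.addNat 2)) (Z 1) := funext fun a => by cases a <;> rfl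
  -- the four truncated series through the bridge
  rw [evalTrunc_eq hrel Γ.Dx Γ.hα eH eH_injective dHhi hHhi0 (fun ℓ s hs hs' => by
        show dHhi (ℓ.addNat 2) s = _; rw [hHhi ℓ s hs hs', (cvals Γ ℓ).1, (cvals Γ ℓ).2.1])
      (fun b hb => by rw [eq_one_of_not_mem_range_eH hb]; exact hHhi1) IHhi hIHhi PHhi hPHhi Z N,
    evalTrunc_eq hrel Γ.D0x Γ.hα eH eH_injective dHlo hHlo0 (fun ℓ s hs hs' => by
        show dHlo (ℓ.addNat 2) s = _; rw [hHlo ℓ s hs hs', (cvals Γ ℓ).2.2.1, (cvals Γ ℓ).2.2.2.1])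
      (fun b hb => by rw [eq_one_of_not_mem_range_eH hb]; exact hHlo1) IHlo hIHlo PHlo hPHlo Z N,
    evalTrunc_eq hrel Γ.Dy Γ.hβ eV eV_injective dVhi hVhi1 (fun ℓ s hs hs' => by
        show dVhi (ℓ.addNat 2) s = _; rw [hVhi ℓ s hs hs', (cvals Γ ℓ).2.2.2.2.1, (cvals Γ ℓ).2.2.2.2.2.1])
      (fun b hb => by rw [eq_zero_of_not_mem_range_eV hb]; exact hVhi0) IVhi hIVhi PVhi hPVhi Z N,
    evalTrunc_eq hrel Γ.D0y Γ.hβ eV eV_injective dVlo hVlo1 (fun ℓ s hs hs' => by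
        show dVlo (ℓ.addNat 2) s = _; rw [hVlo ℓ s hs hs', (cvals Γ ℓ).2.2.2.2.2.2.1, (cvals Γ ℓ).2.2.2.2.2.2.2])
      (fun b hb => by rw [eq_zero_of_not_mem_range_eV hb]; exact hVlo0) IVlo hIVlo PVlo hPVlo Z N,
    hresH, hresV]
  exact Γ.kite.corner_product hrel hmul H
    (fun j hj => by rw [← hresV]; exact Q_eq_zero_of_trunc _ _ Z hN hj)
    (fun j hj => by rw [← hresH]; exact Q_eq_zero_of_trunc _ _ Z hN hj)
    (fun j hj => by rw [← hresH]; exact Q_eq_zero_of_trunc _ _ Z hN hj)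
    (fun j hj => by rw [← hresV]; exact Q_eq_zero_of_trunc _ _ Z hN hj)

omit Γ hrel in
/-- **Registered form of the corner principle for bilinear corner charts** (`corner_principle`, closed
statement). [cite: Furusho2010, §3] -/
theorem cornerPrinciple_chart : ∀ (m : ℕ) (Γ : KZ.Cube.CornerChart m) (R : Type) [CommRing R] [Algebra ℚ R] (χ : KZ.FormalRep →+ R), (∀ c ∈ KZ.relations, χ c = 0) → (∀ x y : KZ.FormalRep, χ (x * y) = χ x * χ y) → ∀ (A : Type) [Ring A] [Algebra R A] [Module ℚ A] [IsScalarTower ℚ R A] (Z : Fin (m + 2) → A) (N : ℕ), (∀ w : List (Fin (m + 2)), N < w.length → (w.map Z).prod = 0) → Commute (Z 0) (Z 1) → (∀ x y : ℚ, 0 ≤ x → x ≤ Γ.α → 0 ≤ y → y ≤ Γ.β → Commute (Z 0 + ∑ ℓ, algebraMap ℚ R ((Γ.cB ℓ + Γ.cD ℓ * y) * x / Γ.φQ ℓ x y) • Z (ℓ.addNat 2)) (Z 1 + ∑ ℓ, algebraMap ℚ R ((Γ.cC ℓ + Γ.cD ℓ * x) * y / Γ.φQ ℓ x y) • Z (ℓ.addNat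 2))) → (∀ y : ℚ, 0 < y → y < Γ.β → Commute (Z 0) (Z 1 + ∑ ℓ, algebraMap ℚ R (Γ.cC ℓ * y / (Γ.cA ℓ + Γ.cC ℓ * y)) • Z (ℓ.addNat 2))) → (∀ x : ℚ, 0 < x → x < Γ.α → Commute (Z 1) (Z 0 + ∑ ℓ, algebraMap ℚ R (Γ.cB ℓ * x / (Γ.cA ℓ + Γ.cB ℓ * x)) • Z (ℓ.addNat 2))) → ∀ (dHlo dHhi dVlo dVhi : Fin (m + 2) → ℝ → ℝ), (∀ s : ℝ, 0 < s → s < Γ.α → dHlo 0 s = 1 / s) → (∀ s : ℝ, 0 < s → s < Γ.α → dHlo 1 s = 0) → (∀ (ℓ : Fin m) (s : ℝ), 0 < s → s < Γ.α → dHlo (ℓ.addNat 2) s = (Γ.cB ℓ : ℝ) / ((Γ.cB ℓ : ℝ) * s + Γ.cA ℓ)) → (∀ s : ℝ, 0 < s → s < Γ.α → dHhi 0 s = 1 / s) → (∀ s : ℝ, 0 < s → s < Γ.α → dHhi 1 s = 0) → (∀ (ℓ : Fin m) (s : ℝ), 0 < s → s < Γ.α → dHhi (ℓ.addNat 2) s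 = ((Γ.cB ℓ + Γ.cD ℓ * Γ.β : ℚ) : ℝ) / (((Γ.cB ℓ + Γ.cD ℓ * Γ.β : ℚ) : ℝ) * s + ((Γ.cA ℓ + Γ.cC ℓ * Γ.β : ℚ) : ℝ))) → (∀ s : ℝ, 0 < s → s < Γ.β → dVlo 1 s = 1 / s) → (∀ s : ℝ, 0 < s → s < Γ.β → dVlo 0 s = 0) → (∀ (ℓ : Fin m) (s : ℝ), 0 < s → s < Γ.β → dVlo (ℓ.addNat 2) s = (Γ.cC ℓ : ℝ) / ((Γ.cC ℓ : ℝ) * s + Γ.cA ℓ)) → (∀ s : ℝ, 0 < s → s < Γ.β → dVhi 1 s = 1 / s) → (∀ s : ℝ, 0 < s → s < Γ.β → dVhi 0 s = 0) → (∀ (ℓ : Fin m) (s : ℝ), 0 < s → s < Γ.β → dVhi (ℓ.addNat 2) s = ((Γ.cC ℓ + Γ.cD ℓ * Γ.α : ℚ) : ℝ) / (((Γ.cC ℓ + Γ.cD ℓ * Γ.α : ℚ) : ℝ) * s + ((Γ.cA ℓ + Γ.cB ℓ * Γ.α : ℚ) : ℝ))) → ∀ (IHlo IHhi IVlo IVhi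 : (w : List (Fin (m + 2))) → KZ.IntegralRep w.length), (∀ w : List (Fin (m + 2)), w.getLast? ≠ some 0 → (IHlo w).domain = {t | (∀ i, 0 < t i ∧ t i < (Γ.α : ℝ)) ∧ StrictAnti t} ∧ Set.EqOn (IHlo w).integrand (fun t => ∏ i, dHlo (w.get i) (t i)) (IHlo w).domain) → (∀ w : List (Fin (m + 2)), w.getLast? ≠ some 0 → (IHhi w).domain = {t | (∀ i, 0 < t i ∧ t i < (Γ.α : ℝ)) ∧ StrictAnti t} ∧ Set.EqOn (IHhi w).integrand (fun t => ∏ i, dHhi (w.get i) (t i)) (IHhi w).domain) → (∀ w : List (Fin (m + 2)), w.getLast? ≠ some 1 → (IVlo w).domain = {t | (∀ i, 0 < t i ∧ t i < (Γ.β : ℝ)) ∧ StrictAnti t} ∧ Set.EqOn (IVlo w).integrand (fun t => ∏ i, dVlo (w.get i) (t i)) (IVlo w).domain) → (∀ w : List (Fin (m + 2)), w.getLast? ≠ some 1 → (IVhi w).domain = {t | (∀ i, 0 < t i ∧ t i < (Γ.β : ℝ)) ∧ StrictAnti t} ∧ Set.EqOn (IVhi w).integrand (fun t => ∏ i, dVhi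 (w.get i) (t i)) (IVhi w).domain) → ∀ (PHlo PHhi PVlo PVhi : NCSeries (Fin (m + 2)) R), (∀ W, PHlo W = if W = [] then 1 else Shuffle.pair (fun w => χ (KZ.of (IHlo w))) (Shuffle.regEnd 0 W)) → (∀ W, PHhi W = if W = [] then 1 else Shuffle.pair (fun w => χ (KZ.of (IHhi w))) (Shuffle.regEnd 0 W)) → (∀ W, PVlo W = if W = [] then 1 else Shuffle.pair (fun w => χ (KZ.of (IVlo w))) (Shuffle.regEnd 1 W)) → (∀ W, PVhi W = if W = [] then 1 else Shuffle.pair (fun w => χ (KZ.of (IVhi w))) (Shuffle.regEnd 1 W)) → NCSeries.evalTrunc N Z PVhi * NCSeries.evalTrunc N Z PHlo = NCSeries.evalTrunc N Z PHhi * NCSeries.evalTrunc N Z PVlo := by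
  intro m Γ R _ _ χ hrel hmul A _ _ _ _ Z N hN h01 F1Q F2Q F3Q dHlo dHhi dVlo dVhi hHlo0 hHlo1 hHlo hHhi0 hHhi1 hHhi hVlo1 hVlo0 hVlo hVhi1 hVhi0 hVhi
    IHlo IHhi IVlo IVhi hIHlo hIHhi hIVlo hIVhi PHlo PHhi PVlo PVhi hPHlo hPHhi hPVlo hPVhi
  exact corner_principle Γ hrel hmul Z hN h01 F1Q F2Q F3Q dHlo dHhi dVlo dVhi hHlo0 hHlo1 hHlo hHhi0 hHhi1 hHhi hVlo1 hVlo0 hVlo hVhi1 hVhi0 hVhi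
    IHlo IHhi IVlo IVhi hIHlo hIHhi hIVlo hIVhi PHlo PHhi PVlo PVhi hPHlo hPHhi hPVlo hPVhi

end CornerPrinciple

namespace CornerTransfer

/-! ## Generic algebra for the transfer of the flatness hypotheses -/

variable {m : ℕ}

/-- Commutator of two scalar combinations of the same residues. [folklore] -/
theorem comm_sum_smul {K : Type} [CommRing K] {A : Type} [Ring A] [Algebra K A] {κ : Type} [Fintype κ] (a b : κ → K) (Z W : κ → A) :
    (∑ k, a k • Z k) * (∑ l, b l • W l) - (∑ l, b l • W l) * (∑ k, a k • Z k) = ∑ k, ∑ l, (a k * b l) • (Z k * W l - W l * Z k) := by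
  have h1 : (∑ k, a k • Z k) * (∑ l, b l • W l) = ∑ k, ∑ l, (a k * b l) • (Z k * W l) := by
    rw [Finset.sum_mul_sum]
    simp only [smul_mul_smul_comm]
  have h2 : (∑ l, b l • W l) * (∑ k, a k • Z k) = ∑ k, ∑ l, (a k * b l) • (W l * Z k) := by
    rw [Finset.sum_mul_sum, Finset.sum_comm]
    simp only [smul_mul_smul_comm, mul_comm (b _) (a _)]
  rw [h1, h2, ← Finset.sum_sub_distrib]
  refine Finset.sum_congr rfl fun k _ => ?_
  rw [← Finset.sum_sub_distrib]
  exact Finset.sum_congr rfl fun l _ => by rw [smul_sub]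

/-- Splitting a sum over `Fin (m + 2)` into the two axes and the divisors. [folklore] -/
theorem sum_fin_add_two {M : Type} [AddCommMonoid M] (F : Fin (m + 2) → M) : ∑ k, F k = F 0 + F 1 + ∑ ℓ : Fin m, F (ℓ.addNat 2) := by
  rw [Fin.sum_univ_succ, Fin.sum_univ_succ]
  simp only [Fin.succ_zero_eq_one, add_assoc]
  rfl

/-- **Scaled commutation of the contracted connections from `F1`-type data** in any algebra: if
`[Σ_k f_k Z_k, Σ_l g_l Z_l] = 0` (as the double sum), `x f₀ = 1`, `f₁ = 0`, `y g₁ = 1`, `g₀ = 0`, then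
`Z₀ + Σ_ℓ x f_{ℓ+2} Z_{ℓ+2}` commutes with `Z₁ + Σ_ℓ y g_{ℓ+2} Z_{ℓ+2}`. [folklore] -/
theorem commute_of_double_sum {K : Type} [CommRing K] {A : Type} [Ring A] [Algebra K A] (f g : Fin (m + 2) → K) (Z : Fin (m + 2) → A) (x y : K)
    (hF : ∑ k, ∑ l, (f k * g l) • (Z k * Z l - Z l * Z k) = 0) (hf0 : x * f 0 = 1) (hf1 : f 1 = 0) (hg1 : y * g 1 = 1) (hg0 : g 0 = 0) :
    Commute (Z 0 + ∑ ℓ : Fin m, (x * f (ℓ.addNat 2)) • Z (ℓ.addNat 2)) (Z 1 + ∑ ℓ : Fin m, (y * g (ℓ.addNat 2)) • Z (ℓ.addNat 2)) := by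
  have hc : Commute (∑ k, f k • Z k) (∑ l, g l • Z l) := by
    rw [Commute, SemiconjBy, ← sub_eq_zero, comm_sum_smul, hF]
  have hX : x • ∑ k, f k • Z k = Z 0 + ∑ ℓ : Fin m, (x * f (ℓ.addNat 2)) • Z (ℓ.addNat 2) := by
    rw [Finset.smul_sum, sum_fin_add_two]
    simp only [smul_smul, hf0, one_smul, hf1, zero_smul, smul_zero, add_zero]
  have hY : y • ∑ l, g l • Z l = Z 1 + ∑ ℓ : Fin m, (y * g (ℓ.addNat 2)) • Z (ℓ.addNat 2) := by
    rw [Finset.smul_sum, sum_fin_add_two]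
    simp only [smul_smul, hg1, one_smul, hg0, zero_smul, smul_zero, zero_add]
  rw [← hX, ← hY]
  exact (hc.smul_left x).smul_right y

/-- **From vanishing coefficients to vanishing values everywhere.** [folklore] -/
theorem sum_aeval_smul_eq_zero {M : Type} [AddCommGroup M] [Module ℚ M] {κ : Type} [Fintype κ] (P : κ → MvPolynomial (Fin 2) ℚ) (v : κ → M)
    (h : ∀ μ : Fin 2 →₀ ℕ, ∑ i, (MvPolynomial.coeff μ (P i)) • v i = 0) (x y : ℚ) :
    ∑ i, (MvPolynomial.aeval ![x, y] (P i)) • v i = 0 := by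
  refine (Module.forall_dual_apply_eq_zero_iff ℚ _).mp fun φ' => ?_
  rw [PolyIdentity.dual_apply_sum_aeval_smul P v φ' x y]
  have hQ : (∑ i, φ' (v i) • P i) = 0 := by
    refine MvPolynomial.ext _ _ fun μ => ?_
    rw [← PolyIdentity.dual_apply_sum_coeff_smul P v φ' μ, h μ, map_zero, MvPolynomial.coeff_zero]
  rw [hQ, map_zero]


end CornerTransfer

end Summit.KontsevichZagierPeriods.FurushoPentagon.PentagonInKZ
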